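import Summits.Ventures.HSemireg.WedgeHankelRecurrenceGaussRadauGolub

/-!
# Venture HSemireg — **GOLUB'S GAUSS–LOBATTO RULE: THE LAST ROW OF THE JACOBI MATRIX IS FREE (1973)**: modifying the two LAST coefficients `a_{t+2} ↦ ã`, `b_{t+2} ↦ b̃ > 0` (so that
# `q̃_n = q_n` for `n ≤ t + 2` and `q̃_{t+3} = (X − ã) q_{t+2} − b̃ q_{t+1}`) gives a `(t+3)`-point Favard rule `(ν, y)` that is STILL exact for the reference rule in degree `≤ 2t + 3`:
# `Σ_K ν_K f(y_K) = Σ_K M_K f(X_K)` (`(M, X)` the `(t+2)`-point Favard rule of `q`); choosing `ã, b̃` so that `q̃_{t+3}(c) = q̃_{t+3}(d) = 0` (Golub's `2 × 2` system) prescribes the two nodes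
# `c, d` — the Gauss–Lobatto rule

HONEST FRAMING. Part of the Lean index of the computation cell `pub-hsemireg` (seat p10 gen 45, Sunday typer «UNIFORM-IN-n»).  Real polynomials and finite sums only (`Polynomial.modByMonic`); no
variety, no cohomology theory, no sheaf, no Ext group and no semiregularity map is constructed here; nothing here says that HC / HC_CM / HC_AV holds; no Literature fact (unproved `Prop`) is declared
or used.  Custodian versions as in `WedgeHankelSiegelIdeal` (1/3).
SOURCES (cited).  G. H. Golub, *Some modified matrix eigenvalue problems*, SIAM Rev. 15 (1973) 318–334, §7 (Gauss–Lobatto by modifying `α_{n+2}`, `β_{n+1}`, eq. (7.3)); W. Gautschi, *Orthogonal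
Polynomials: Computation and Approximation* (2004) §3.1.1.3, Thm 3.5; G. H. Golub, G. Meurant, *Matrices, Moments and Quadrature with Applications* (2010) §6.2.
PROOF TYPED HERE.  With `L(F) = Σ M F(X)`: `L(q̃_{t+3} q_j) = −b̃ L(q_{t+1} q_j) = 0` for `j ≤ t` (`q_{t+2}(X_K) = 0`); N366 `functional_vanish_of_monic_family` extends to `deg G ≤ t` and identifies
the rules in degree `≤ t + 2`; division by the monic `q̃_{t+3}` gives exactness in degree `≤ (t + 3) + t`.  The nodes: `q̃_{t+3}(c) = (c − ã) q_{t+2}(c) − b̃ q_{t+1}(c)`.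
DEDUP DISCLOSURE (`rg -n 'lobatto' Summits/Ventures/HSemireg`, 2026-09-03): N278 (construction from the Gauss rule of `(V−c)(d−V)M`), N351 (uniqueness); Golub's free-last-row form is new.
The 5 names below: 0 hits tree-wide.

WHAT IS IN THE TREE.  N366 `functional_vanish_of_monic_family`, `sum_mul_eval_mul_add`, `sum_mul_eval_mul_smul`; N323 `favard_pairing_at_zeros`; N279 `recurrence_monic_natDegree`; N347
`rank_one_perturbation_eq_below` pattern; Mathlib `Polynomial.modByMonic_add_div`, `natDegree_modByMonic_lt`, `natDegree_divByMonic`.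
THIS FILE (namespace `Summit.Ventures.HSemireg.Wedge.HankelOuter` continued; CHAINED on N367 (import only); 0 definitions):
* §1133 `lobattoGolub_recurrence_eq` (`q̃_n = q_n`, `n ≤ t+2`; `q̃_{t+3} = (X − ã) q_{t+2} − b̃ q_{t+1}`), **`lobattoGolub_nodes`** (the linear conditions on `(ã, b̃)` that make `c`, `d` zeros),
  `lobattoGolub_top_orthogonal` (`Σ M (q̃_{t+3} G)(X) = 0`, `deg G ≤ t`), **`lobattoGolub_exact`** (`Σ ν f(y) = Σ M f(X)`, `deg f ≤ 2t+3`), **`lobattoGolub_rule`** (packaged, positive weights).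
CAVEATS.  Positive recurrences with `b̃ > 0` assumed (Golub proves `b̃ > 0` for `c < X_0`, `X_{t+1} < d`; not typed); the reference functional is the `(t+2)`-point Favard rule.  Nothing
Ext-side.  New names only.
-/

open Module Polynomial
open scoped Matrix Polynomial

namespace Summit.Ventures.HSemireg.Wedge.HankelOuter

/-! ## §1133. Gauss–Lobatto by a free last row -/

/-- **Modifying the last row: `q̃_n = q_n` for `n ≤ t + 2` and `q̃_{t+3} = (X − a'_{t+2}) q_{t+2} − b'_{t+2} q_{t+1}`.** [Golub 1973 §7; this file, §1133] -/
theorem lobattoGolub_recurrence_eq {q q' : ℕ → ℝ[X]} {a a' b b' : ℕ → ℝ} (hq0 : q 0 = 1) (hq1 : q 1 = Polynomial.X - C (a 0))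
    (hrec : ∀ n, q (n + 2) = (Polynomial.X - C (a (n + 1))) * q (n + 1) - C (b (n + 1)) * q n)
    (hq0' : q' 0 = 1) (hq1' : q' 1 = Polynomial.X - C (a' 0)) (hrec' : ∀ n, q' (n + 2) = (Polynomial.X - C (a' (n + 1))) * q' (n + 1) - C (b' (n + 1)) * q' n)
    {t : ℕ} (ha' : ∀ n, n ≠ t + 2 → a' n = a n) (hb' : ∀ n, n ≠ t + 2 → b' n = b n) :
    (∀ n, n ≤ t + 2 → q' n = q n) ∧ q' (t + 3) = (Polynomial.X - C (a' (t + 2))) * q (t + 2) - C (b' (t + 2)) * q (t + 1) := by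
  have key : ∀ n, n ≤ t + 2 → q' n = q n ∧ (n + 1 ≤ t + 2 → q' (n + 1) = q (n + 1)) := by
    intro n
    induction n with
    | zero => exact fun _ => ⟨by rw [hq0, hq0'], fun _ => by rw [hq1, hq1', ha' 0 (by omega)]⟩
    | succ n ih =>
      intro hn
      obtain ⟨h0, h1⟩ := ih (by omega)
      refine ⟨h1 hn, fun h2 => ?_⟩
      rw [show n + 1 + 1 = n + 2 by ring, hrec n, hrec' n, h0, h1 hn, ha' (n + 1) (by omega), hb' (n + 1) (by omega)]
  have hbelow : ∀ n, n ≤ t + 2 → q' n = q n := fun n hn => (key n hn).1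
  exact ⟨hbelow, by rw [show t + 3 = (t + 1) + 2 by ring, hrec' (t + 1), hbelow (t + 2) le_rfl, hbelow (t + 1) (by omega)]⟩

/-- **The prescribed nodes: if `(c − ã) q_{t+2}(c) = b̃ q_{t+1}(c)` then `q̃_{t+3}(c) = 0`** (and likewise for `d`; Golub's `2 × 2` system for `(ã, b̃)`). [Golub 1973 (7.3); this file, §1133] -/
theorem lobattoGolub_nodes {q q' : ℕ → ℝ[X]} {a a' b b' : ℕ → ℝ} (hq0 : q 0 = 1) (hq1 : q 1 = Polynomial.X - C (a 0))
    (hrec : ∀ n, q (n + 2) = (Polynomial.X - C (a (n + 1))) * q (n + 1) - C (b (n + 1)) * q n)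
    (hq0' : q' 0 = 1) (hq1' : q' 1 = Polynomial.X - C (a' 0)) (hrec' : ∀ n, q' (n + 2) = (Polynomial.X - C (a' (n + 1))) * q' (n + 1) - C (b' (n + 1)) * q' n)
    {t : ℕ} (ha' : ∀ n, n ≠ t + 2 → a' n = a n) (hb' : ∀ n, n ≠ t + 2 → b' n = b n) {c : ℝ}
    (hc : (c - a' (t + 2)) * (q (t + 2)).eval c = b' (t + 2) * (q (t + 1)).eval c) : (q' (t + 3)).eval c = 0 := by
  obtain ⟨-, htop⟩ := lobattoGolub_recurrence_eq hq0 hq1 hrec hq0' hq1' hrec' ha' hb'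
  rw [htop]
  simp only [eval_sub, eval_mul, eval_X, eval_C]
  linarith

/-- **`Σ_K M_K (q̃_{t+3} G)(X_K) = 0` for `deg G ≤ t`** (`(M, X)` the level-`(t+1)` Favard pairing of `q`; any `ã`, `b̃`). [Golub 1973 §7; this file, §1133] -/
theorem lobattoGolub_top_orthogonal {q : ℕ → ℝ[X]} {a b : ℕ → ℝ} (hq0 : q 0 = 1) (hq1 : q 1 = Polynomial.X - C (a 0))
    (hrec : ∀ n, q (n + 2) = (Polynomial.X - C (a (n + 1))) * q (n + 1) - C (b (n + 1)) * q n)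
    {t : ℕ} {M X : Fin (t + 2) → ℝ} (hXr : ∀ k, (q (t + 2)).eval (X k) = 0)
    (hPair : ∀ i j : Fin (t + 2), ∑ k, M k * ((q i).eval (X k) * (q j).eval (X k)) = if i = j then ∏ l ∈ Finset.Ico 1 ((j : ℕ) + 1), b l else 0)
    (s r : ℝ) {G : ℝ[X]} (hG : G.natDegree ≤ t) :
    ∑ k, M k * (((Polynomial.X - C s) * q (t + 2) - C r * q (t + 1)) * G).eval (X k) = 0 := by
  refine functional_vanish_of_monic_family (Φ := fun F => ∑ k, M k * (((Polynomial.X - C s) * q (t + 2) - C r * q (t + 1)) * F).eval (X k))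
    (fun F G => by simp only [sum_mul_eval_mul_add]) (fun c F => by simp only [sum_mul_eval_mul_smul])
    (fun d hd => (recurrence_monic_natDegree hq0 hq1 hrec d).1) (fun d hd => (recurrence_monic_natDegree hq0 hq1 hrec d).2) (fun d hd => ?_) hG
  have h := hPair ⟨t + 1, by omega⟩ ⟨d, by omega⟩
  rw [if_neg (fun h' => by have := Fin.mk.inj_iff.1 h'; omega)] at h
  dsimp only at h
  have e : ∀ k, M k * (((Polynomial.X - C s) * q (t + 2) - C r * q (t + 1)) * q d).eval (X k) = -r * (M k * ((q (t + 1)).eval (X k) * (q d).eval (X k))) := fun k => by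
    simp only [eval_mul, eval_sub, eval_X, eval_C, hXr k, mul_zero, zero_sub]; ring
  rw [Finset.sum_congr rfl fun k _ => e k, ← Finset.mul_sum, h, mul_zero]

/-- **GOLUB'S LOBATTO THEOREM: `Σ_K ν_K f(y_K) = Σ_K M_K f(X_K)` for `deg f ≤ 2t + 3`** (`(ν, y)` the level-`(t+2)` Favard pairing of the modified recurrence — `t + 3` nodes —, `(M, X)` the
level-`(t+1)` pairing of `q`). [Golub 1973 §7; Gautschi Thm 3.5; this file, §1133] -/
theorem lobattoGolub_exact {q q' : ℕ → ℝ[X]} {a a' b b' : ℕ → ℝ} (hq0 : q 0 = 1) (hq1 : q 1 = Polynomial.X - C (a 0))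
    (hrec : ∀ n, q (n + 2) = (Polynomial.X - C (a (n + 1))) * q (n + 1) - C (b (n + 1)) * q n)
    (hq0' : q' 0 = 1) (hq1' : q' 1 = Polynomial.X - C (a' 0)) (hrec' : ∀ n, q' (n + 2) = (Polynomial.X - C (a' (n + 1))) * q' (n + 1) - C (b' (n + 1)) * q' n)
    {t : ℕ} (ha' : ∀ n, n ≠ t + 2 → a' n = a n) (hb' : ∀ n, n ≠ t + 2 → b' n = b n) {M X : Fin (t + 2) → ℝ} {ν y : Fin (t + 3) → ℝ}
    (hXq : q (t + 2) = ∏ k, (Polynomial.X - C (X k))) (hyq : q' (t + 3) = ∏ k, (Polynomial.X - C (y k)))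
    (hPair : ∀ i j : Fin (t + 2), ∑ k, M k * ((q i).eval (X k) * (q j).eval (X k)) = if i = j then ∏ l ∈ Finset.Ico 1 ((j : ℕ) + 1), b l else 0)
    (hpair' : ∀ i j : Fin (t + 3), ∑ k, ν k * ((q' i).eval (y k) * (q' j).eval (y k)) = if i = j then ∏ l ∈ Finset.Ico 1 ((j : ℕ) + 1), b' l else 0)
    {f : ℝ[X]} (hf : f.natDegree ≤ 2 * t + 3) : ∑ k, ν k * f.eval (y k) = ∑ k, M k * f.eval (X k) := by
  have hXr : ∀ k, (q (t + 2)).eval (X k) = 0 := fun k => by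
    rw [hXq, eval_prod]; exact Finset.prod_eq_zero (Finset.mem_univ k) (by rw [eval_sub, eval_X, eval_C, sub_self])
  have hyr : ∀ k, (q' (t + 3)).eval (y k) = 0 := fun k => by
    rw [hyq, eval_prod]; exact Finset.prod_eq_zero (Finset.mem_univ k) (by rw [eval_sub, eval_X, eval_C, sub_self])
  obtain ⟨hbelow, htop⟩ := lobattoGolub_recurrence_eq hq0 hq1 hrec hq0' hq1' hrec' ha' hb'
  obtain ⟨hm', hd'⟩ := recurrence_monic_natDegree hq0' hq1' hrec' (t + 3)
  -- low degree: the two rules agree in degree `≤ t + 2`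
  have hlow : ∀ R : ℝ[X], R.natDegree ≤ t + 2 → ∑ k, ν k * R.eval (y k) = ∑ k, M k * R.eval (X k) := fun R hR => by
    have h := functional_vanish_of_monic_family (Φ := fun F => ∑ k, ν k * F.eval (y k) - ∑ k, M k * F.eval (X k))
      (fun F G => by
        have h1 := sum_mul_eval_mul_add ν y 1 F G; have h2 := sum_mul_eval_mul_add M X 1 F G
        simp only [one_mul] at h1 h2; rw [h1, h2]; ring)
      (fun c F => by
        have h1 := sum_mul_eval_mul_smul ν y 1 F c; have h2 := sum_mul_eval_mul_smul M X 1 F c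
        simp only [one_mul] at h1 h2; rw [h1, h2]; ring)
      (fun d hd => (recurrence_monic_natDegree hq0 hq1 hrec d).1) (fun d hd => (recurrence_monic_natDegree hq0 hq1 hrec d).2) (fun d hd => ?_) hR
    · simpa [sub_eq_zero] using h
    · have h1 := hpair' ⟨d, by omega⟩ ⟨0, by omega⟩
      rw [hbelow d hd, hq0'] at h1
      simp only [eval_one, mul_one] at h1
      rw [h1]
      rcases Nat.lt_or_ge d (t + 2) with hd2 | hd2
      · have h2 := hPair ⟨d, hd2⟩ ⟨0, by omega⟩
        rw [hq0] at h2
        simp only [eval_one, mul_one] at h2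
        rw [h2]
        by_cases hd0 : d = 0
        · subst hd0; simp
        · rw [if_neg (fun h' => hd0 (by have := Fin.mk.inj_iff.1 h'; omega)), if_neg (fun h' => hd0 (by have := Fin.mk.inj_iff.1 h'; omega)), sub_self]
      · have hdt : d = t + 2 := by omega
        subst hdt
        rw [if_neg (fun h' => by have := Fin.mk.inj_iff.1 h'; omega), Finset.sum_eq_zero (fun k _ => by rw [hXr k, mul_zero]), sub_self]
  obtain ⟨G, hG⟩ : ∃ G : ℝ[X], G = f /ₘ q' (t + 3) := ⟨_, rfl⟩
  obtain ⟨R, hR⟩ : ∃ R : ℝ[X], R = f %ₘ q' (t + 3) := ⟨_, rfl⟩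
  have hfGR : f = q' (t + 3) * G + R := by rw [hG, hR, add_comm, modByMonic_add_div f (q' (t + 3))]
  have hRd : R.natDegree ≤ t + 2 := by
    have hne : q' (t + 3) ≠ 1 := fun h => by have := congrArg natDegree h; rw [hd', natDegree_one] at this; omega
    have := natDegree_modByMonic_lt f hm' hne
    rw [hd'] at this; rw [hR]; omega
  have hGd : G.natDegree ≤ t := by rw [hG, natDegree_divByMonic f hm', hd']; omega
  have h1 := lobattoGolub_top_orthogonal hq0 hq1 hrec hXr hPair (a' (t + 2)) (b' (t + 2)) hGd
  rw [← htop] at h1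
  have h3 : ∑ k, ν k * f.eval (y k) = ∑ k, ν k * R.eval (y k) := Finset.sum_congr rfl fun k _ => by rw [hfGR, eval_add, eval_mul, hyr k, zero_mul, zero_add]
  have h4 : ∑ k, M k * f.eval (X k) = ∑ k, M k * (q' (t + 3) * G).eval (X k) + ∑ k, M k * R.eval (X k) := by
    rw [← Finset.sum_add_distrib]; exact Finset.sum_congr rfl fun k _ => by rw [hfGR, eval_add]; ring
  rw [h3, h4, h1, zero_add, hlow R hRd]

/-- **THE GAUSS–LOBATTO RULE À LA GOLUB, PACKAGED**: positive recurrence, `b̃ = b'_{t+2} > 0`, `(ã, b̃)` satisfying Golub's conditions at `c` and `d`; with `X` the zeros of `q_{t+2}` and `y` those of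
`q̃_{t+3}`: `c` and `d` are nodes, and there are POSITIVE weights `M, ν` with `Σ ν f(y) = Σ M f(X)` for `deg f ≤ 2t + 3`. [Golub 1973 §7; this file, §1133] -/
theorem lobattoGolub_rule {q q' : ℕ → ℝ[X]} {a a' b b' : ℕ → ℝ} (hq0 : q 0 = 1) (hq1 : q 1 = Polynomial.X - C (a 0))
    (hrec : ∀ n, q (n + 2) = (Polynomial.X - C (a (n + 1))) * q (n + 1) - C (b (n + 1)) * q n)
    (hq0' : q' 0 = 1) (hq1' : q' 1 = Polynomial.X - C (a' 0)) (hrec' : ∀ n, q' (n + 2) = (Polynomial.X - C (a' (n + 1))) * q' (n + 1) - C (b' (n + 1)) * q' n)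
    (hb : ∀ j, 0 < b j) {t : ℕ} (ha' : ∀ n, n ≠ t + 2 → a' n = a n) (hb' : ∀ n, n ≠ t + 2 → b' n = b n) (hbt : 0 < b' (t + 2)) {c d : ℝ}
    (hc : (c - a' (t + 2)) * (q (t + 2)).eval c = b' (t + 2) * (q (t + 1)).eval c) (hd : (d - a' (t + 2)) * (q (t + 2)).eval d = b' (t + 2) * (q (t + 1)).eval d)
    {X : Fin (t + 2) → ℝ} {y : Fin (t + 3) → ℝ} (hX : StrictMono X) (hXq : q (t + 2) = ∏ k, (Polynomial.X - C (X k))) (hy : StrictMono y) (hyq : q' (t + 3) = ∏ k, (Polynomial.X - C (y k))) :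
    (∃ K, y K = c) ∧ (∃ K, y K = d) ∧ ∃ (M : Fin (t + 2) → ℝ) (ν : Fin (t + 3) → ℝ), (∀ k, 0 < M k) ∧ (∀ k, 0 < ν k) ∧
      ∀ f : ℝ[X], f.natDegree ≤ 2 * t + 3 → ∑ k, ν k * f.eval (y k) = ∑ k, M k * f.eval (X k) := by
  have hb'pos : ∀ j, 0 < b' j := fun j => by
    by_cases h : j = t + 2
    · rw [h]; exact hbt
    · rw [hb' j h]; exact hb j
  obtain ⟨M, hM, hPair⟩ := favard_pairing_at_zeros hq0 hq1 hrec hb (t := t + 1) hX hXq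
  obtain ⟨ν, hν, hpair'⟩ := favard_pairing_at_zeros hq0' hq1' hrec' hb'pos (t := t + 2) hy hyq
  have hnode : ∀ e : ℝ, (e - a' (t + 2)) * (q (t + 2)).eval e = b' (t + 2) * (q (t + 1)).eval e → ∃ K, y K = e := fun e he => by
    have h0 := lobattoGolub_nodes hq0 hq1 hrec hq0' hq1' hrec' ha' hb' he
    rw [hyq, eval_prod, Finset.prod_eq_zero_iff] at h0
    obtain ⟨K, -, hK⟩ := h0
    rw [eval_sub, eval_X, eval_C, sub_eq_zero] at hK
    exact ⟨K, hK.symm⟩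
  exact ⟨hnode c hc, hnode d hd, M, ν, hM, hν, fun f hf => lobattoGolub_exact hq0 hq1 hrec hq0' hq1' hrec' ha' hb' hXq hyq hPair hpair' hf⟩

end Summit.Ventures.HSemireg.Wedge.HankelOuter
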